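import Literature.NumberTheory.Automorphic.SmoothRepresentationProofs
import Mathlib.Analysis.Matrix.Normed
import Mathlib.LinearAlgebra.Matrix.ToLin
import Mathlib.LinearAlgebra.Dimension.Free
import HarnessLib

/-!
# The projector `e_K`, Hecke multiplicativity on `V^K`, and exponential growth of matrix
coefficients along products of generators

Topic `NumberTheory/Automorphic`; theorems only (no definition, no named fact), abstract
representation theory on top of `SmoothRepresentationProofs` (finite orbits,
`sum_mem_fixedPoints_of_finite_orbit`). Setting: a representation `ρ` of a group `G` on a vector
space `V` over a field `k` of characteristic zero, a subgroup `K ≤ G`, and a `K`-invariant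
projector `e : V → V^K` in the sense of `Representation.IsSmooth.exists_fixedPoints_projection`
(`e = id` on `V^K`, `e ∘ ρ(g) = e` for `g ∈ K`) — the operator `π(e_K) = ∫_K π(g) dg` of the
printed sources, here Haar-measure free.

* `projector_apply_eq_smul_sum`: `e v` is the average of the (finite) `K`-orbit of `v`;
  `apply_projector_eq`: `ψ ∘ e = ψ` for a `K`-invariant linear form `ψ`.
* `projector_apply_apply_projector_apply` (**Hecke multiplicativity**): if `a K b ⊆ K (a b) K`
  then `e ρ(a) e ρ(b) w = e ρ(a b) w` on `V^K`, i.e. `T_a T_b = T_{ab}` for the operators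
  `T_g = e ρ(g)|_{V^K}` — the identity `[K a K][K b K] = [K a b K]` of double-coset operators
  (Casselman (1995), Lemma 4.1.5; Bernstein–Zelevinsky (1976), §3).
* `exists_norm_apply_list_prod_le` (**exponential growth**, `k = ℂ`, `V^K` finite-dimensional):
  given a finite set `S` of generators and a set `D ∋ 1` of dominant elements with `S D ⊆ D` and
  the inclusions `a K b ⊆ K a b K` (`a ∈ S`, `b ∈ D`), there is `M ≥ 1` such that
  `|ψ(ρ(a₁ ⋯ a_ℓ) w)| ≤ C(w, ψ) M^ℓ` for all `a_i ∈ S`, `K`-fixed `w` and `K`-invariant `ψ`: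
  `T_{a₁ ⋯ a_ℓ} = T_{a₁} ⋯ T_{a_ℓ}`, and in a basis of `V^K` a product of `ℓ` matrices of
  `ℓ^∞`-operator norm `≤ M` has entries `≤ M^ℓ` (`Matrix.linftyOpNormedRing`). This is the
  Hecke-algebra half of the standard proof that admissible matrix coefficients grow at most
  exponentially along the dominant cone (used for `GL_n` in `GodementJacquetLocalConvergenceProofs`).

## References

* W. Casselman, *Introduction to the theory of admissible representations of 𝔭-adic reductive
  groups* (1995 notes), §2.1 (the projectors `P_K`), Lemma 4.1.5.
* I. N. Bernstein, A. V. Zelevinsky, *Representations of the group `GL(n, F)` where `F` is a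
  non-archimedean local field*, Russian Math. Surveys 31:3 (1976), §2–§3 [BernsteinZelevinsky1976].
* D. Bump, *Automorphic Forms and Representations* (1997), §4.2 (the idempotents `ε_{K₀}`),
  §4.6 [Bump1997].
-/

set_option autoImplicit false

noncomputable section

open scoped Matrix

namespace Literature.NumberTheory.Automorphic


section Projector

variable {k G V : Type*} [Field k] [CharZero k] [Group G] [AddCommGroup V] [Module k V]
  (ρ : Representation k G V) (K : Subgroup G) {e : V →ₗ[k] V}

/-- **The projector `e_K` is the orbit average.** Let `e : V → V` be `k`-linear with
`e ∘ ρ(g) = e` for `g ∈ K` and `e = id` on `V^K`. If the `K`-orbit `S` of `v` is finite, then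
`e v = |S|⁻¹ ∑_{x ∈ S} x` (the sum is `K`-fixed, `e` fixes it, and `e` is constant on the
orbit). (Bump (1997), §4.2, pp. 425–429, the idempotents `ε_{K₀}`; Bernstein–Zelevinsky (1976),
§2.) [folklore] -/
theorem projector_apply_eq_smul_sum (he₂ : ∀ v ∈ ρ.fixedPoints K, e v = v)
    (he₃ : ∀ g ∈ K, ∀ v, e (ρ g v) = e v) {v : V}
    (hfin : ((fun g : G => ρ g v) '' (K : Set G)).Finite) :
    e v = ((hfin.toFinset.card : k)⁻¹) • ∑ x ∈ hfin.toFinset, x := by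
  have hw := ρ.sum_mem_fixedPoints_of_finite_orbit K v hfin
  have h1 : e (∑ x ∈ hfin.toFinset, x) = hfin.toFinset.card • e v := by
    rw [map_sum, ← Finset.sum_const]
    refine Finset.sum_congr rfl fun x hx => ?_
    obtain ⟨g, hg, rfl⟩ := (Set.Finite.mem_toFinset hfin).1 hx
    exact he₃ g hg v
  rw [he₂ _ hw] at h1
  have hv : v ∈ hfin.toFinset := (Set.Finite.mem_toFinset hfin).2 ⟨1, K.one_mem, by simp⟩
  have hcard : (hfin.toFinset.card : k) ≠ 0 := Nat.cast_ne_zero.2 (Finset.card_ne_zero_of_mem hv)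
  rw [h1, ← Nat.cast_smul_eq_nsmul k, smul_smul, inv_mul_cancel₀ hcard, one_smul]

/-- A `K`-invariant linear form is unchanged by the projector: `ψ (e v) = ψ v`. [folklore] -/
theorem apply_projector_eq (he₂ : ∀ v ∈ ρ.fixedPoints K, e v = v)
    (he₃ : ∀ g ∈ K, ∀ v, e (ρ g v) = e v) {ψ : Module.Dual k V}
    (hψ : ∀ g ∈ K, ∀ v, ψ (ρ g v) = ψ v) {v : V}
    (hfin : ((fun g : G => ρ g v) '' (K : Set G)).Finite) : ψ (e v) = ψ v := by
  rw [projector_apply_eq_smul_sum ρ K he₂ he₃ hfin, map_smul, map_sum]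
  have h1 : ∑ x ∈ hfin.toFinset, ψ x = hfin.toFinset.card • ψ v := by
    rw [← Finset.sum_const]
    refine Finset.sum_congr rfl fun x hx => ?_
    obtain ⟨g, hg, rfl⟩ := (Set.Finite.mem_toFinset hfin).1 hx
    exact hψ g hg v
  have hv : v ∈ hfin.toFinset := (Set.Finite.mem_toFinset hfin).2 ⟨1, K.one_mem, by simp⟩
  have hcard : (hfin.toFinset.card : k) ≠ 0 := Nat.cast_ne_zero.2 (Finset.card_ne_zero_of_mem hv)
  rw [h1, ← Nat.cast_smul_eq_nsmul k, smul_smul, inv_mul_cancel₀ hcard, one_smul]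

/-- **Hecke multiplicativity from a double-coset inclusion.** With `e` as above, if
`a K b ⊆ K (a b) K` then `e ρ(a) e ρ(b) w = e ρ(a b) w` for every `K`-fixed `w` whose vector
`ρ(b) w` has finite `K`-orbit: expanding `e ρ(b) w` as the orbit average, each term
`e ρ(a κ b) w = e ρ(κ₁ a b κ₂) w = e ρ(a b) w`. This is the identity
`[K a K] · [K b K] = [K a b K]` of Hecke operators on `V^K` (Bernstein–Zelevinsky (1976), §3;
Casselman, *Introduction to the theory of admissible representations* (1995), Lemma 4.1.5).
[folklore] -/
theorem projector_apply_apply_projector_apply (he₂ : ∀ v ∈ ρ.fixedPoints K, e v = v)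
    (he₃ : ∀ g ∈ K, ∀ v, e (ρ g v) = e v) {a b : G}
    (hab : ∀ κ ∈ K, ∃ κ₁ ∈ K, ∃ κ₂ ∈ K, a * κ * b = κ₁ * (a * b) * κ₂) {w : V}
    (hw : w ∈ ρ.fixedPoints K) (hfin : ((fun g : G => ρ g (ρ b w)) '' (K : Set G)).Finite) :
    e (ρ a (e (ρ b w))) = e (ρ (a * b) w) := by
  rw [projector_apply_eq_smul_sum ρ K he₂ he₃ hfin, map_smul, map_smul, map_sum, map_sum]
  have h1 : ∑ x ∈ hfin.toFinset, e (ρ a x) = hfin.toFinset.card • e (ρ (a * b) w) := by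
    rw [← Finset.sum_const]
    refine Finset.sum_congr rfl fun x hx => ?_
    obtain ⟨κ, hκ, rfl⟩ := (Set.Finite.mem_toFinset hfin).1 hx
    obtain ⟨κ₁, hκ₁, κ₂, hκ₂, hκκ⟩ := hab κ hκ
    have hκ₂w : ρ κ₂ w = w := (ρ.mem_fixedPoints K w).1 hw κ₂ hκ₂
    calc e (ρ a (ρ κ (ρ b w))) = e (ρ (a * κ * b) w) := by
          simp only [map_mul, Module.End.mul_apply]
      _ = e (ρ κ₁ (ρ (a * b) (ρ κ₂ w))) := by
          rw [hκκ]; simp only [map_mul, Module.End.mul_apply]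
      _ = e (ρ (a * b) w) := by rw [hκ₂w, he₃ κ₁ hκ₁]
  have hv : ρ b w ∈ hfin.toFinset := (Set.Finite.mem_toFinset hfin).2 ⟨1, K.one_mem, by simp⟩
  have hcard : (hfin.toFinset.card : k) ≠ 0 := Nat.cast_ne_zero.2 (Finset.card_ne_zero_of_mem hv)
  rw [h1, ← Nat.cast_smul_eq_nsmul k, smul_smul, inv_mul_cancel₀ hcard, one_smul]

end Projector

section Growth

variable {G V : Type*} [Group G] [AddCommGroup V] [Module ℂ V]
  (ρ : Representation ℂ G V) (K : Subgroup G)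

/-- Entries are bounded by the `ℓ^∞`-operator norm of a matrix. [folklore] -/
theorem norm_apply_le_linfty_opNorm {m : ℕ} (A : Matrix (Fin m) (Fin m) ℂ) (i j : Fin m) :
    ‖A i j‖ ≤ @Norm.norm _ Matrix.linftyOpNormedRing.toNorm A := by
  letI : NormedRing (Matrix (Fin m) (Fin m) ℂ) := Matrix.linftyOpNormedRing
  rw [Matrix.linfty_opNorm_def]
  have h1 : ‖A i j‖₊ ≤ ∑ j', ‖A i j'‖₊ :=
    Finset.single_le_sum (f := fun j' => ‖A i j'‖₊) (fun _ _ => zero_le) (Finset.mem_univ j)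
  have h2 : ∑ j', ‖A i j'‖₊ ≤ Finset.univ.sup fun i' => ∑ j', ‖A i' j'‖₊ :=
    Finset.le_sup (f := fun i' => ∑ j', ‖A i' j'‖₊) (Finset.mem_univ i)
  exact_mod_cast h1.trans h2

/-- In a seminormed ring, a non-empty product of elements of norm `≤ M` has norm `≤ M^ℓ`.
[folklore] -/
theorem norm_list_prod_le_pow {R : Type*} [SeminormedRing R] {M : ℝ} (hM : 0 ≤ M) :
    ∀ l : List R, l ≠ [] → (∀ x ∈ l, ‖x‖ ≤ M) → ‖l.prod‖ ≤ M ^ l.length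
  | [], h, _ => absurd rfl h
  | [a], _, h => by simpa using h a (by simp)
  | a :: b :: l, _, h => by
    rw [List.prod_cons, List.length_cons, pow_succ']
    refine (norm_mul_le _ _).trans (mul_le_mul (h a (by simp)) ?_ (norm_nonneg _) hM)
    exact norm_list_prod_le_pow hM (b :: l) (by simp) fun x hx => h x (List.mem_cons_of_mem a hx)

/-- **Exponential growth of matrix coefficients along products of generators.** Let `e` be a
`K`-invariant projector onto the finite-dimensional `V^K` (`e = id` on `V^K`, `e ∘ ρ(g) = e` for
`g ∈ K`, all `K`-orbits finite), `S` a finite set of "generators" and `D ∋ 1` a set of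
"dominant" elements with `S · D ⊆ D` and the double-coset inclusions `a K b ⊆ K a b K`
(`a ∈ S`, `b ∈ D`). Then there is `M ≥ 1` such that for every `K`-fixed `w` and every
`K`-invariant linear form `ψ` there is `C ≥ 0` with
`|ψ(ρ(a₁ ⋯ a_ℓ) w)| ≤ C M^ℓ` for all `a₁, …, a_ℓ ∈ S`: by Hecke multiplicativity
`T_{a₁⋯a_ℓ} = T_{a₁} ⋯ T_{a_ℓ}` for the operators `T_g = e ρ(g)|_{V^K}`, and a product of `ℓ`
matrices has entries bounded by `M^ℓ` for `M` the maximum of `1` and the operator norms of the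
`T_a`, `a ∈ S`. (The standard Hecke-algebra argument for the growth of admissible matrix
coefficients; Casselman, *Introduction to the theory of admissible representations*, §4.) [folklore] -/
theorem exists_norm_apply_list_prod_le {e : V →ₗ[ℂ] V} (he₁ : ∀ v, e v ∈ ρ.fixedPoints K)
    (he₂ : ∀ v ∈ ρ.fixedPoints K, e v = v) (he₃ : ∀ g ∈ K, ∀ v, e (ρ g v) = e v)
    (hfin : ∀ v : V, ((fun g : G => ρ g v) '' (K : Set G)).Finite)
    [Module.Finite ℂ (ρ.fixedPoints K)] (S : Finset G) (D : Set G) (h1 : (1 : G) ∈ D)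
    (hmul : ∀ a ∈ S, ∀ b ∈ D, a * b ∈ D)
    (hD : ∀ a ∈ S, ∀ b ∈ D, ∀ κ ∈ K, ∃ κ₁ ∈ K, ∃ κ₂ ∈ K, a * κ * b = κ₁ * (a * b) * κ₂) :
    ∃ M : ℝ, 1 ≤ M ∧ ∀ w ∈ ρ.fixedPoints K, ∀ ψ : Module.Dual ℂ V,
      (∀ g ∈ K, ∀ v, ψ (ρ g v) = ψ v) →
      ∃ C : ℝ, 0 ≤ C ∧ ∀ l : List G, (∀ a ∈ l, a ∈ S) → ‖ψ (ρ l.prod w)‖ ≤ C * M ^ l.length := by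
  classical
  set W : Submodule ℂ V := ρ.fixedPoints K with hW
  -- a basis of `W` and the operators `T_g = e ρ(g)|_W`
  set d : ℕ := Module.finrank ℂ W with hd
  let b : Module.Basis (Fin d) ℂ W := Module.finBasis ℂ W
  let T : G → Module.End ℂ W := fun g =>
    LinearMap.codRestrict W (e ∘ₗ ρ g ∘ₗ W.subtype) fun w => he₁ _
  have hT : ∀ g (w : W), ((T g w : W) : V) = e (ρ g (w : V)) := fun g w => rfl
  -- multiplicativity
  have hTone : T 1 = 1 := by
    ext w
    rw [hT, map_one, Module.End.one_apply, Module.End.one_apply, he₂ _ w.2]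
  have hTmul : ∀ a ∈ S, ∀ b' ∈ D, T (a * b') = T a * T b' := by
    intro a ha b' hb'
    ext w
    rw [Module.End.mul_apply, hT, hT, hT]
    exact (projector_apply_apply_projector_apply ρ K he₂ he₃ (hD a ha b' hb') w.2 (hfin _)).symm
  have hprodD : ∀ l : List G, (∀ a ∈ l, a ∈ S) → l.prod ∈ D := by
    intro l
    induction l with
    | nil => intro; simpa using h1
    | cons a l ih =>
      intro hl
      rw [List.prod_cons]
      exact hmul a (hl a List.mem_cons_self) _ (ih fun x hx => hl x (List.mem_cons_of_mem a hx))
  have hTprod : ∀ l : List G, (∀ a ∈ l, a ∈ S) → T l.prod = (l.map T).prod := by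
    intro l
    induction l with
    | nil => intro; simpa using hTone
    | cons a l ih =>
      intro hl
      rw [List.prod_cons, List.map_cons, List.prod_cons,
        hTmul a (hl a List.mem_cons_self) _ (hprodD l fun x hx => hl x (List.mem_cons_of_mem a hx)),
        ih fun x hx => hl x (List.mem_cons_of_mem a hx)]
  -- matrices and norms
  letI : NormedRing (Matrix (Fin d) (Fin d) ℂ) := Matrix.linftyOpNormedRing
  let A : G → Matrix (Fin d) (Fin d) ℂ := fun g => LinearMap.toMatrix b b (T g)
  have hAprod : ∀ l : List G, (∀ a ∈ l, a ∈ S) →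
      LinearMap.toMatrix b b (T l.prod) = (l.map A).prod := by
    intro l hl
    rw [hTprod l hl]
    change LinearMap.toMatrixAlgEquiv b (l.map T).prod = (l.map A).prod
    rw [map_list_prod, List.map_map]
    rfl
  set M : ℝ := 1 + ∑ a ∈ S, ‖A a‖ with hM
  have hM1 : 1 ≤ M := by
    rw [hM]
    exact le_add_of_nonneg_right (Finset.sum_nonneg fun a _ => norm_nonneg _)
  have hMa : ∀ a ∈ S, ‖A a‖ ≤ M := fun a ha => by
    rw [hM]
    exact (Finset.single_le_sum (f := fun a => ‖A a‖) (fun _ _ => norm_nonneg _) ha).trans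
      (le_add_of_nonneg_left zero_le_one)
  -- entries of the matrix of `T (l.prod)` are bounded by `M ^ l.length`
  have hentry : ∀ l : List G, (∀ a ∈ l, a ∈ S) → ∀ i j,
      ‖LinearMap.toMatrix b b (T l.prod) i j‖ ≤ M ^ l.length := by
    intro l hl i j
    rw [hAprod l hl]
    rcases l with _ | ⟨a, l⟩
    · simp only [List.map_nil, List.prod_nil, List.length_nil, pow_zero]
      rw [Matrix.one_apply]
      split_ifs <;> simp
    · refine (norm_apply_le_linfty_opNorm _ i j).trans ?_
      have h := norm_list_prod_le_pow (zero_le_one.trans hM1) ((a :: l).map A) (by simp)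
        fun y hy => by
          obtain ⟨x, hx, rfl⟩ := List.mem_map.1 hy
          exact hMa x (hl x hx)
      rwa [List.length_map] at h
  refine ⟨M, hM1, fun w hw ψ hψ => ?_⟩
  -- the constant `C = ∑_{i,j} |c_j| |ψ(b_i)|`, `c = b.repr w`
  set c : Fin d → ℂ := fun j => b.repr ⟨w, hw⟩ j with hc
  set C : ℝ := ∑ i, ∑ j, ‖c j‖ * ‖ψ ((b i : W) : V)‖ with hC
  have hC0 : 0 ≤ C := Finset.sum_nonneg fun i _ => Finset.sum_nonneg fun j _ =>
    mul_nonneg (norm_nonneg _) (norm_nonneg _)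
  refine ⟨C, hC0, fun l hl => ?_⟩
  -- `ψ (ρ g w) = ψ (e (ρ g w)) = ∑_{i,j} A_{ij} c_j ψ(b_i)`
  have hexp : ψ (ρ l.prod w) =
      ∑ i, ∑ j, LinearMap.toMatrix b b (T l.prod) i j * c j * ψ ((b i : W) : V) := by
    have h0 : ψ (ρ l.prod w) = ψ ((T l.prod ⟨w, hw⟩ : W) : V) := by
      rw [hT, apply_projector_eq ρ K he₂ he₃ hψ (hfin _)]
    rw [h0]
    conv_lhs => rw [← b.sum_repr (T l.prod ⟨w, hw⟩)]
    rw [Submodule.coe_sum, map_sum]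
    refine Finset.sum_congr rfl fun i _ => ?_
    rw [Submodule.coe_smul, map_smul, smul_eq_mul, ← LinearMap.toMatrix_mulVec_repr b b (T l.prod)
      ⟨w, hw⟩, Matrix.mulVec, dotProduct, Finset.sum_mul]
  rw [hexp]
  calc ‖∑ i, ∑ j, LinearMap.toMatrix b b (T l.prod) i j * c j * ψ ((b i : W) : V)‖
      ≤ ∑ i, ∑ j, ‖LinearMap.toMatrix b b (T l.prod) i j * c j * ψ ((b i : W) : V)‖ :=
        (norm_sum_le _ _).trans (Finset.sum_le_sum fun i _ => norm_sum_le _ _)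
    _ ≤ ∑ i, ∑ j, M ^ l.length * (‖c j‖ * ‖ψ ((b i : W) : V)‖) :=
        Finset.sum_le_sum fun i _ => Finset.sum_le_sum fun j _ => by
          rw [norm_mul, norm_mul, mul_assoc]
          exact mul_le_mul_of_nonneg_right (hentry l hl i j)
            (mul_nonneg (norm_nonneg _) (norm_nonneg _))
    _ = C * M ^ l.length := by
        rw [hC, Finset.sum_mul]
        refine Finset.sum_congr rfl fun i _ => ?_
        rw [Finset.sum_mul]
        refine Finset.sum_congr rfl fun j _ => ?_
        ring

end Growth

end Literature.NumberTheory.Automorphic
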